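import Mathlib.Algebra.Lie.InvariantForm
import Literature.Algebra.Lie.LefschetzModule
import HarnessLib

/-!
# Invariant bilinear forms on Lefschetz modules: `f_a` preserves every form that `h` and `e_a` preserve (Looijenga–Lunts 1997, §1 (1.3)), without non-degeneracy

Topic `Literature/Algebra/Lie` (namespace `Literature.Algebra.Lie`).  Lane `lit-hodgefound` (Track 2 foundations
library), skeleton seat `lit-hodgefound-skel-1` (generation 40), row **A1-97** of
`run/shared/lean/pub/lit-hodgefound/SKELETON.md`.  Sequel of `LefschetzModule.lean` §9 (row A1-91), which proved (1.3)
for a NON-DEGENERATE form `φ` through the uniqueness of `φ`-adjoints (its TODO(general form)); here the printed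
generality — ANY bilinear form `φ`, possibly degenerate — by the weight argument the authors themselves give in the
proof of (1.6): "If we regard `φ` as an element of `M^* ⊗ M^*` of degree zero, then the fact that `φ` is killed by `e_a`
implies that it is killed by `f_a`."  THEOREMS ONLY (no definition, no named fact, no `sorry`; D-0026 net debt `0`), in
Mathlib's vocabulary: `LinearMap.BilinForm`, `LinearMap.BilinForm.IsSkewAdjoint`, the Lie module structure of Mathlib on
bilinear forms (`LinearMap.instLieRingModule` + `Module.Dual.instLieRingModule`: `(x · φ)(y, z) = -φ(y, x z) - φ(x y, z)`),
`IsSl2Triple.HasPrimitiveVectorWith`, `LinearMap.BilinForm.lieInvariant` (`Mathlib/Algebra/Lie/InvariantForm`), and the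
tree's `IsZGrading`, `degreeSpace`, `lefschetzLieAlgebra`, `IsLefschetzModule`, `skewAdjointLieSubalgebra`.  As in the
parent file the commutator Lie ring of `𝔤𝔩(M) = Module.End K M` is Mathlib's reducible non-instance
`LieRing.ofAssociativeRing`, enabled FILE-LOCALLY.

## Source, VERBATIM

E. Looijenga, V. A. Lunts, *A Lie algebra attached to a projective variety*, Invent. Math. **129** (1997) 361–412
(held text `paper:arxiv-alg-geom_9604014`, page/line numbers of that text):

> (§1 (1.3), p0005 L1–L9) "Given a Lefschetz module `M` of `𝔞`, then an invariant bilinear form on `M` is a bilinear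
> map `φ : M × M → K` that defines a morphism of Lefschetz modules `M ⊗ M → K` (where `𝔞` acts trivially on `K`): so
> `φ` is zero on `M_k × M_l` unless `k + l = 0` and `𝔞` preserves the form `φ` infinitesimally:
> `φ(e_a m, m') + φ(m, e_a m') = 0` for all `m, m' ∈ M` and `a ∈ 𝔞`. If `a` is a Lefschetz element, then the
> Jacobson–Morozov lemma implies that `f_a` also preserves `φ` infinitesimally. So `𝔤(𝔞, M)` is then a subalgebra
> of `aut(M, φ)`."
> (§1 (1.6), proof, p0005 L92–L94) "If we regard `φ` as an element of `M^* ⊗ M^*` of degree zero, then the fact that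
> `φ` is killed by `e_a` implies that it is killed by `f_a`. So `𝔤(𝔞, M)` preserves `φ` infinitesimally."

## Rendering and proof

* "`φ(x m, m') + φ(m, x m') = 0`" = Mathlib `B.IsSkewAdjoint x` = "`x · φ = 0`" for Mathlib's action of `𝔤𝔩(M)` on
  bilinear forms (`isSkewAdjoint_iff_lie_eq_zero`; `lie_bilinForm_apply`).  "`φ` is zero on `M_k × M_l` unless
  `k + l = 0`" ⟺ `B.IsSkewAdjoint h` on a `ℤ`-graded `(M, h)` in characteristic `0` (⟹ is A1-91's
  `apply_eq_zero_of_isSkewAdjoint_of_mem_degreeSpace`; ⟸ is `isSkewAdjoint_of_forall_apply_eq_zero` below) — so an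
  "invariant bilinear form" in the printed sense is exactly a `φ` with `h · φ = 0` and `e_a · φ = 0` for all `a ∈ 𝔞`.
* **`isSkewAdjoint_of_isSl2Triple'`**: for an `𝔰𝔩₂`-triple `(e, h, f)` in `𝔤𝔩(M)` (`M` finite-dimensional,
  characteristic `0`) and ANY bilinear `φ` with `h · φ = 0 = e · φ`, also `f · φ = 0`.  Printed proof ("killed by `e_a`
  implies killed by `f_a`"): `ψ := f · φ` satisfies `h · ψ = -2ψ` and `e · ψ = h · φ = 0`, so `ψ` would be a primitive
  vector of weight `-2` in the finite-dimensional `𝔰𝔩₂`-module of bilinear forms — impossible unless `ψ = 0` (Mathlib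
  `IsSl2Triple.HasPrimitiveVectorWith.exists_nat`; the same argument as the tree's `f_eq_of_isSl2Triple`).  No grading and
  no non-degeneracy are needed.
* Consequences: `HasLefschetzProperty.isSkewAdjoint_dual'`, **`lefschetzLieAlgebra_le_skewAdjointLieSubalgebra'`**
  ("`𝔤(𝔞, M)` is then a subalgebra of `aut(M, φ)`", Mathlib `skewAdjointLieSubalgebra φ`, now for every invariant
  `φ`), `IsLefschetzModule.isSkewAdjoint_of_mem'`; and in Mathlib's language of invariant forms on Lie modules,
  `lieInvariant_iff_forall_isSkewAdjoint` and **`lieInvariant_lefschetzLieAlgebra`** (`φ.lieInvariant 𝔤(𝔞, M)` for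
  the action of the Lie subalgebra `𝔤(𝔞, M) ≤ 𝔤𝔩(M)` on `M`).

## SCOPE (not formalised)

The tensor product `M ⊗ M → K` / `M^* ⊗ M^*` phrasing itself (only its content `x · φ = 0`); the last sentence of
(1.3) ("any Lefschetz module with nondegenerate bilinear form is the perpendicular direct sum of Lefschetz modules that
are irreducible orthogonal, irreducible symplectic, or the direct sum of an irreducible Lefschetz module with its
dual") and the notions orthogonal / symplectic representation.

## References

* [LooijengaLunts1997] E. Looijenga, V. A. Lunts, *A Lie algebra attached to a projective variety*, Invent. Math. 129
  (1997) 361–412; arXiv:alg-geom/9604014. §1 (1.3) p. 5 L1–L9; (1.6) proof p. 5 L92–L94 (held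
  `paper:arxiv-alg-geom_9604014`).
* [Bourbaki2008LieGroups79] N. Bourbaki, *Lie Groups and Lie Algebras, Chapters 7–9*, Ch. VIII §1 no. 2 (primitive elements of
  `𝔰𝔩₂`-modules) — the weight argument, as packaged in Mathlib's `IsSl2Triple.HasPrimitiveVectorWith`.
-/

noncomputable section

namespace Literature.Algebra.Lie

open Module Function Set LieModule
open LinearMap (BilinForm)

-- The commutator Lie ring of `𝔤𝔩(M) = Module.End K M`: Mathlib's reducible NON-instance
-- `LieRing.ofAssociativeRing`, enabled file-locally exactly as in `LefschetzModule.lean` / `Sl2PartnerUnique.lean`.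
attribute [local instance 100] LieRing.ofAssociativeRing

/-! ### §1 "preserves `φ` infinitesimally" = "kills `φ`" for the action of `𝔤𝔩(M)` on bilinear forms -/

section Action

variable {K : Type*} [Field K] {M : Type*} [AddCommGroup M] [Module K M] {B : BilinForm K M}
  {h x : Module.End K M}

/-- **The action of `𝔤𝔩(M)` on bilinear forms** ("`M ⊗ M → K` (where `𝔞` acts trivially on `K`)", i.e. `φ` as an
element of the `𝔤𝔩(M)`-module `M^* ⊗ M^*`), which Mathlib provides on `M →ₗ M →ₗ K`:
`(x · φ)(y, z) = -φ(y, x z) - φ(x y, z)`. [cite: LooijengaLunts1997, §1 (1.3) p0005 L1–L6, (1.6) proof p0005 L92–L93] -/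
theorem lie_bilinForm_apply (x : Module.End K M) (B : BilinForm K M) (y z : M) :
    (⁅x, B⁆ : BilinForm K M) y z = -B y (x z) - B (x y) z := by
  rw [LieHom.lie_apply, LinearMap.sub_apply, Module.Dual.lie_apply, Module.End.lie_apply, Module.End.lie_apply]

/-- **"`𝔞` preserves the form `φ` infinitesimally: `φ(e_a m, m') + φ(m, e_a m') = 0`"** is Mathlib's
`φ.IsSkewAdjoint e_a`, and says exactly that `e_a` KILLS `φ` in the module of bilinear forms.
[cite: LooijengaLunts1997, §1 (1.3) p0005 L4–L6, (1.6) proof p0005 L92–L93 ("φ is killed by e_a")] -/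
theorem isSkewAdjoint_iff_lie_eq_zero : B.IsSkewAdjoint x ↔ ⁅x, B⁆ = 0 := by
  constructor
  · intro hx
    ext y z
    rw [lie_bilinForm_apply, LinearMap.zero_apply, LinearMap.zero_apply]
    have h1 := hx y z
    rw [Pi.neg_apply, map_neg] at h1
    rw [h1]; ring
  · intro hx y z
    have h1 := LinearMap.congr_fun₂ hx y z
    rw [lie_bilinForm_apply, LinearMap.zero_apply, LinearMap.zero_apply] at h1
    rw [Pi.neg_apply, map_neg]
    linear_combination (norm := skip) -h1
    ring

/-- **"`φ` is zero on `M_k × M_l` unless `k + l = 0`" implies that `h` preserves `φ` infinitesimally** on a `ℤ`-graded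
`(M, h)` (the converse of A1-91's `apply_eq_zero_of_isSkewAdjoint_of_mem_degreeSpace`): on `M_k × M_l` one has
`φ(h x, y) + φ(x, h y) = (k + l) φ(x, y)`, which vanishes in either case. [cite: LooijengaLunts1997, §1 (1.3) p0005 L3–L4] -/
theorem isSkewAdjoint_of_forall_apply_eq_zero (hgr : IsZGrading h)
    (h0 : ∀ k l : ℤ, k + l ≠ 0 → ∀ x ∈ degreeSpace h k, ∀ y ∈ degreeSpace h l, B x y = 0) : B.IsSkewAdjoint h := by
  intro x y
  rw [Pi.neg_apply, map_neg, ← add_eq_zero_iff_eq_neg]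
  have hx : x ∈ ⨆ k : ℤ, degreeSpace h k := by rw [hgr]; exact Submodule.mem_top
  have hy : y ∈ ⨆ l : ℤ, degreeSpace h l := by rw [hgr]; exact Submodule.mem_top
  refine Submodule.iSup_induction (fun k : ℤ ↦ degreeSpace h k) (motive := fun x ↦ B (h x) y + B x (h y) = 0) hx
    (fun k x hx ↦ ?_) (by rw [map_zero, map_zero, LinearMap.zero_apply, LinearMap.zero_apply, add_zero])
    (fun x x' hx hx' ↦ by rw [map_add, map_add, map_add, LinearMap.add_apply, LinearMap.add_apply,
      add_add_add_comm, hx, hx', add_zero])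
  refine Submodule.iSup_induction (fun l : ℤ ↦ degreeSpace h l) (motive := fun y ↦ B (h x) y + B x (h y) = 0) hy
    (fun l y hy ↦ ?_) (by rw [map_zero, map_zero, map_zero, add_zero])
    (fun y y' hy hy' ↦ by rw [map_add, map_add, map_add, add_add_add_comm, hy, hy', add_zero])
  rw [mem_degreeSpace_iff.1 hx, mem_degreeSpace_iff.1 hy, map_smul, LinearMap.smul_apply, map_smul, smul_eq_mul,
    smul_eq_mul, ← add_mul, ← Int.cast_add]
  by_cases hkl : k + l = 0
  · rw [hkl, Int.cast_zero, zero_mul]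
  · rw [h0 k l hkl x hx y hy, mul_zero]

end Action

/-! ### §2 (1.3): `f_a` preserves every form that `h` and `e_a` preserve -/

section Partner

variable {K : Type*} [Field K] [CharZero K] {M : Type*} [AddCommGroup M] [Module K M] [FiniteDimensional K M]
  {B : BilinForm K M} {h e f : Module.End K M}

/-- **(1.3) in the printed generality: "If `a` is a Lefschetz element, then … `f_a` also preserves `φ` infinitesimally"
— for ANY bilinear form `φ` (possibly degenerate) preserved by `h` and `e`, and any `𝔰𝔩₂`-triple `(e, h, f)` in `𝔤𝔩(M)`
(`M` finite-dimensional, characteristic `0`).**  Printed proof ((1.6)): "If we regard `φ` as an element of `M^* ⊗ M^*` of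
degree zero, then the fact that `φ` is killed by `e_a` implies that it is killed by `f_a`": `ψ := f · φ` has
`h · ψ = [h, f] · φ + f · (h · φ) = -2ψ` and `e · ψ = [e, f] · φ + f · (e · φ) = h · φ = 0`, so a non-zero `ψ` would be
a primitive vector of negative weight `-2` in the finite-dimensional `𝔰𝔩₂`-module of bilinear forms, contradicting
Mathlib's `IsSl2Triple.HasPrimitiveVectorWith.exists_nat`.  (The two bracket identities are checked pointwise, using
`f h = h f + 2f` and `f e = e f - h` on vectors.)  Supersedes A1-91's `isSkewAdjoint_of_isSl2Triple`, which assumed `φ`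
non-degenerate. [cite: LooijengaLunts1997, §1 (1.3) p0005 L6–L8, (1.6) proof p0005 L92–L94] -/
theorem isSkewAdjoint_of_isSl2Triple' (t : IsSl2Triple h e f) (hh : B.IsSkewAdjoint h) (he : B.IsSkewAdjoint e) :
    B.IsSkewAdjoint f := by
  have hh' : ∀ u v, B (h u) v = -B u (h v) := fun u v ↦ by rw [hh u v, Pi.neg_apply, map_neg]
  have he' : ∀ u v, B (e u) v = -B u (e v) := fun u v ↦ by rw [he u v, Pi.neg_apply, map_neg]
  -- `f h = h f + 2 f` and `f e = e f - h`, pointwise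
  have hfh : ∀ u, f (h u) = h (f u) + (2 : K) • f u := by
    intro u
    have h1 := LinearMap.congr_fun (t.lie_lie_smul_f K) u
    rw [Ring.lie_def, LinearMap.sub_apply, Module.End.mul_apply, Module.End.mul_apply, LinearMap.neg_apply,
      LinearMap.smul_apply] at h1
    rw [← sub_eq_iff_eq_add', ← neg_sub, h1, neg_neg]
  have hfe : ∀ u, f (e u) = e (f u) - h u := by
    intro u
    have h1 := LinearMap.congr_fun t.lie_e_f u
    rw [Ring.lie_def, LinearMap.sub_apply, Module.End.mul_apply, Module.End.mul_apply] at h1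
    rw [← h1, sub_sub_cancel]
  by_contra hne
  rw [isSkewAdjoint_iff_lie_eq_zero] at hne
  have P : t.HasPrimitiveVectorWith (⁅f, B⁆ : BilinForm K M) (-2 : K) :=
    { ne_zero := hne
      lie_h := by
        ext y z
        simp only [lie_bilinForm_apply, LinearMap.smul_apply, hfh, map_add, map_smul, LinearMap.add_apply,
          smul_eq_mul, hh']
        ring
      lie_e := by
        ext y z
        simp only [lie_bilinForm_apply, LinearMap.zero_apply, LinearMap.sub_apply, hfe, map_sub, he']
        rw [hh' y z]
        ring }
  obtain ⟨n, hn⟩ := P.exists_nat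
  have h2 : ((n + 2 : ℕ) : K) = 0 := by push_cast; rw [← hn]; ring
  exact absurd (Nat.cast_eq_zero.1 h2) (by omega)

/-- (1.3) for a Lefschetz operator: **the constructed partner `f = HasLefschetzProperty.dual` of `e` preserves every
form that `h` and `e` preserve** (no non-degeneracy; compare A1-91's `HasLefschetzProperty.isSkewAdjoint_dual`).
[cite: LooijengaLunts1997, §1 (1.3) p0005 L6–L8] -/
theorem HasLefschetzProperty.isSkewAdjoint_dual' (L : HasLefschetzProperty h e) (hgr : IsZGrading h) (h0 : h ≠ 0)
    (hh : B.IsSkewAdjoint h) (he : B.IsSkewAdjoint e) : B.IsSkewAdjoint (L.dual hgr) :=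
  isSkewAdjoint_of_isSl2Triple' (L.isSl2Triple_dual hgr h0) hh he

variable {𝔞 : Submodule K (Module.End K M)}

/-- **"So `𝔤(𝔞, M)` is then a subalgebra of `aut(M, φ)`"**, for EVERY bilinear form `φ` preserved infinitesimally by `h`
and by the `e_a`, `a ∈ 𝔞` (Mathlib's `skewAdjointLieSubalgebra φ`; A1-91's unprimed version assumed `φ` non-degenerate).
[cite: LooijengaLunts1997, §1 (1.3) p0005 L8–L9] -/
theorem lefschetzLieAlgebra_le_skewAdjointLieSubalgebra' (hh : B.IsSkewAdjoint h)
    (h𝔞 : ∀ a ∈ 𝔞, B.IsSkewAdjoint a) : lefschetzLieAlgebra K h 𝔞 ≤ skewAdjointLieSubalgebra B := by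
  rw [lefschetzLieAlgebra_le_iff]
  refine ⟨fun a ha ↦ ?_, ?_⟩
  · rw [SetLike.mem_coe]
    exact (LinearMap.mem_skewAdjointSubmodule a).2 (h𝔞 a ha)
  · rintro f' ⟨a, ha, t⟩
    rw [SetLike.mem_coe]
    exact (LinearMap.mem_skewAdjointSubmodule f').2 (isSkewAdjoint_of_isSl2Triple' t hh (h𝔞 a ha))

/-- … elementwise: every `x ∈ 𝔤(𝔞, M)` preserves `φ` infinitesimally. [cite: LooijengaLunts1997, §1 (1.3) p0005 L8–L9] -/
theorem isSkewAdjoint_of_mem_lefschetzLieAlgebra' (hh : B.IsSkewAdjoint h) (h𝔞 : ∀ a ∈ 𝔞, B.IsSkewAdjoint a)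
    {x : Module.End K M} (hx : x ∈ lefschetzLieAlgebra K h 𝔞) : B.IsSkewAdjoint x :=
  (LinearMap.mem_skewAdjointSubmodule x).1 (lefschetzLieAlgebra_le_skewAdjointLieSubalgebra' hh h𝔞 hx)

/-- … for a Lefschetz module `(𝔞, M)` with an invariant bilinear form in the printed sense ("zero on `M_k × M_l` unless
`k + l = 0` and `𝔞` preserves `φ`"): `𝔤(𝔞, M) ≤ 𝔞𝔲𝔱(M, φ)`. [cite: LooijengaLunts1997, §1 (1.3) p0005 L1–L9] -/
theorem IsLefschetzModule.isSkewAdjoint_of_mem' (A : IsLefschetzModule K h 𝔞)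
    (h0 : ∀ k l : ℤ, k + l ≠ 0 → ∀ x ∈ degreeSpace h k, ∀ y ∈ degreeSpace h l, B x y = 0)
    (h𝔞 : ∀ a ∈ 𝔞, B.IsSkewAdjoint a) {x : Module.End K M} (hx : x ∈ lefschetzLieAlgebra K h 𝔞) :
    B.IsSkewAdjoint x :=
  isSkewAdjoint_of_mem_lefschetzLieAlgebra' (isSkewAdjoint_of_forall_apply_eq_zero A.isZGrading h0) h𝔞 hx

end Partner

/-! ### §3 In Mathlib's language of invariant forms on Lie modules -/

section LieInvariant

variable {K : Type*} [Field K] {M : Type*} [AddCommGroup M] [Module K M] {B : BilinForm K M}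

/-- For a Lie subalgebra `𝔤 ≤ 𝔤𝔩(M)` acting on `M`, Mathlib's `φ.lieInvariant 𝔤` ("`φ ⁅x, y⁆ z = -φ y ⁅x, z⁆`") says
that every `x ∈ 𝔤` preserves `φ` infinitesimally. [cite: LooijengaLunts1997, §1 (1.3) p0005 L4–L9] -/
theorem lieInvariant_iff_forall_isSkewAdjoint (G : LieSubalgebra K (Module.End K M)) :
    B.lieInvariant G ↔ ∀ x ∈ G, B.IsSkewAdjoint x := by
  constructor
  · intro hB x hx y z
    have h1 := hB ⟨x, hx⟩ y z
    rw [LieSubalgebra.coe_bracket_of_module, LieSubalgebra.coe_bracket_of_module, Module.End.lie_apply,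
      Module.End.lie_apply] at h1
    rw [Pi.neg_apply, map_neg, h1]
  · intro hB x y z
    have h1 := hB x x.2 y z
    rw [Pi.neg_apply, map_neg] at h1
    rw [LieSubalgebra.coe_bracket_of_module, LieSubalgebra.coe_bracket_of_module, Module.End.lie_apply,
      Module.End.lie_apply, h1]

variable [CharZero K] [FiniteDimensional K M] {h : Module.End K M} {𝔞 : Submodule K (Module.End K M)}

/-- **"So `𝔤(𝔞, M)` is then a subalgebra of `aut(M, φ)`" as a Mathlib `lieInvariant` statement**: a bilinear form
preserved by `h` and by the `e_a` (`a ∈ 𝔞`) is an invariant form of the `𝔤(𝔞, M)`-module `M` — so Mathlib's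
invariant-form API (`LinearMap.BilinForm.orthogonal` of a Lie submodule as a Lie submodule, …) applies to Lefschetz
modules. [cite: LooijengaLunts1997, §1 (1.3) p0005 L8–L9] -/
theorem lieInvariant_lefschetzLieAlgebra (hh : B.IsSkewAdjoint h) (h𝔞 : ∀ a ∈ 𝔞, B.IsSkewAdjoint a) :
    B.lieInvariant (lefschetzLieAlgebra K h 𝔞) :=
  (lieInvariant_iff_forall_isSkewAdjoint _).2 fun _ hx ↦ isSkewAdjoint_of_mem_lefschetzLieAlgebra' hh h𝔞 hx

end LieInvariant

end Literature.Algebra.Lie
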